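import Summits.BirchSwinnertonDyer.BirchSwinnertonDyer.Theorems.PrintCf2RubinValueTwoKatzMeasureJZeroSupplyOfPerLevel
import Summits.BirchSwinnertonDyer.BirchSwinnertonDyer.Theses.PrintCf2RubinValueTwo
import Literature.NumberTheory.EllipticCurves.DeShalit1987.KatzMeasureJZero
import HarnessLib

set_option linter.dupNamespace false
set_option autoImplicit false

/-!
# THE LAST LINK BY NAME: the route-C leaf `KatzDistributionsAtTwoJZeroClassOne` (stmt-BirchSwinnertonDyer-30221) from the five
# de Shalit II.2 prints and the per-level class-sum identity `P1` (kernel certificate; proofs only)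

Cell `bsd-print-cf2`, width seat `bsd-line-cf2c-w4` g17; `--supports stmt-BirchSwinnertonDyer-30221` (helper).  THEOREMS ONLY; no `def`,
no named fact, no `sorry`.  Nothing is closed: `P1` and the prints stay hypotheses.

WHAT.  `katzDistributionsAtTwoJZeroClassOne_of_perLevel (h24i h24ii h24iii h25 h27) (hP1 : P1) : KatzDistributionsAtTwoJZeroClassOne` — the
composition, BY NAME and with no unfolding by hand, of
* `KatzMeasureJZeroTop.lMeasureJZero_classNumberOne_two_of_perLevel` (p769392, width `-w3` g31: the R3 endpoint
  `lMeasureJZero_classNumberOne_two` VERBATIM from the prints and `P1`), and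
* `DeShalit1987.katzDistributions₂₀_of_inlineLMeasures₀_classNumberOne 2` (Literature `DeShalit1987/KatzMeasureJZero`, p758994: the inline
  `j = 0` measure statement ⟹ the `j = 0` distribution currency `IsKatzDistribution₂₀`),
landing on the ROUTE DECL `Summit.BirchSwinnertonDyer.BirchSwinnertonDyer.Theses.PrintCf2RubinValueTwo.KatzDistributionsAtTwoJZeroClassOne`
(item 30221) TOKEN-EXACT — so the kernel certifies the two textual identities the plan relies on («the R3 endpoint is the `hν` of the
Literature lemma at `p = 2`», «its output is the aside 24720′ verbatim»), and the LEAD's closer of 30221 is ONE application: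
`katzDistributionsAtTwoJZeroClassOne_of_perLevel h24i h24ii h24iii h25 h27 (P1_of_lane …)` once the bridge `P1_of_lane` (=
`P1_of_perUnitValues … (perUnitValues_of_lane …)`, widths `-w3`/`-w8`/LEAD) is in the tree.  `P1` = the binder `hP1` of
`katzSeamSupply_two_of_perLevel` VERBATIM.

HONEST FRAMING: a two-token composition of accepted theorems; 30221 / 24720 / 20368 are NOT closed by this file (its hypotheses are the five
prints and `P1`); no summit statement is proved; BSD is not proved by any of this.

References: [deShalit1987] E. de Shalit, *Iwasawa theory of elliptic curves with complex multiplication* (1987), II.4.12 (31) (p. 66–67),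
II.4.14 (36)–(40) (p. 71–73), II.4.16 (49)–(50) (p. 76–77), II.4.17 (54) (p. 78).
-/

noncomputable section

open scoped NumberField Classical nonZeroDivisors
open NumberField IsDedekindDomain Field
open IsDedekindDomain.HeightOneSpectrum ValuativeRel IsLocalRing
open Literature Literature.NumberTheory.GaloisRepresentations Literature.NumberTheory.EllipticCurves
open Literature.NumberTheory.GaloisRepresentations.IsNonarchimedeanLocalField Literature.NumberTheory.GaloisRepresentations.LubinTate
  Literature.NumberTheory.GaloisRepresentations.ArtinLocalGlobal Literature.NumberTheory.PAdicHodge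
open Literature.NumberTheory.LFunctions Literature.NumberTheory.NumberFields
open Literature.NumberTheory.EllipticCurves.GroupDistribution Literature.NumberTheory.ComplexMultiplication.EllipticUnits
open Literature.NumberTheory.LFunctions.AbelianDensity (artinSymbol)
open Literature.NumberTheory.EllipticCurves.DeShalit1987 Literature.NumberTheory.GaloisRepresentations.HeckeCharacter
open Summit.BirchSwinnertonDyer.BirchSwinnertonDyer.Theorems.PrintCf2.EllipticUnitsLocal
  Summit.BirchSwinnertonDyer.BirchSwinnertonDyer.Theorems.PrintCf2.EllipticUnitsGlobal
  Summit.BirchSwinnertonDyer.BirchSwinnertonDyer.Theorems.PrintCf2.EllipticUnitsTwoVariable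
open MvPowerSeries

namespace Summit.BirchSwinnertonDyer.BirchSwinnertonDyer.Theorems.PrintCf2.KatzMeasureJZeroTop

section LastLink

attribute [local instance] ltNormUniformSpace ltNormIsUniformAddGroup rk1 nF nE fintypeResidueField
attribute [local instance] RelNormCoherentUnits.instCommMonoid GlobalNormCoherentUnits.instCommMonoid GlobalNormCoherentUnits.galAction

set_option maxHeartbeats 1600000 in
/-- ★★★ **The route-C leaf `KatzDistributionsAtTwoJZeroClassOne` (30221) from the five de Shalit II.2 prints and `P1`**, by name:
`katzDistributions₂₀_of_inlineLMeasures₀_classNumberOne 2 ∘ lMeasureJZero_classNumberOne_two_of_perLevel`.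
[cite: deShalit1987, II.4.12 (31) (p. 66–67), II.4.14 (36)–(40) (p. 71–73), II.4.16 (49)–(50) (p. 76–77), II.4.17 (54) (p. 78)] -/
theorem katzDistributionsAtTwoJZeroClassOne_of_perLevel
    (h24i : DeShalit1987.prop24_i_mem_rayClassField) (h24ii : DeShalit1987.prop24_ii_galoisAction)
    (h24iii : DeShalit1987.prop24_iii_unit) (h25 : DeShalit1987.prop25_i_normRelation) (h27 : DeShalit1987.prop27_power)
    (hP1 : ∀ (K : Type) [Field K] [NumberField K] [IsTotallyComplex K]
      (hK : IsImaginaryQuadratic K) (_ : NumberField.classNumber K = 1)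
      (ι : PadicAlgCl 2 ≃+* ℂ) (w₀ : InfinitePlace K) (v vbar : HeightOneSpectrum (𝓞 K))
        (hv2 : ((2 : ℕ) : 𝓞 K) ∈ v.asIdeal) (hvbar2 : ((2 : ℕ) : 𝓞 K) ∈ vbar.asIdeal) (hne : vbar ≠ v)
        (_ : ∀ (w : InfinitePlace K) (k : 𝓞 K), k ∈ v.asIdeal ↔ ‖ι.symm (w.embedding (k : K))‖ < 1)
        {α₀ : 𝓞 K} (hv0 : v.asIdeal = Ideal.span {α₀})
        (hdK : NumberField.discr K = -7) (hα₀ : α₀ ^ 2 - α₀ + 2 = 0)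
        (hw2 : ∀ uu : (𝓞 K)ˣ, (uu : 𝓞 K) - 1 ∈ vbar.asIdeal ^ 2 → uu = 1)
    (hq : residueFieldCard (v.adicCompletion K) = 2)
    (h2 : (valuation (v.adicCompletion K)).IsUniformizer ((((2 : ℕ) : 𝒪[v.adicCompletion K]) : v.adicCompletion K)))
    (u : 𝒪[v.adicCompletion K]ˣ)
    (hu : ((((u : 𝒪[v.adicCompletion K]) * ((2 : ℕ) : 𝒪[v.adicCompletion K]) : 𝒪[v.adicCompletion K]) : v.adicCompletion K)) = ((α₀ : K) : v.adicCompletion K))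
    {σ₀ : absoluteGaloisGroup (v.adicCompletion K)} (hσ₀ : IsAbsArithFrob σ₀)
    {ε : (maxUnramifiedCompletion (v.adicCompletion K))ˣ}
    (hε : maxUnramifiedCompletion.galAut (v.adicCompletion K) σ₀ (ε : maxUnramifiedCompletion (v.adicCompletion K)) =
      algebraMap 𝒪[v.adicCompletion K] (maxUnramifiedCompletion (v.adicCompletion K)) (u : 𝒪[v.adicCompletion K]) * (ε : maxUnramifiedCompletion (v.adicCompletion K)))
    (θ : CompletedAlgClosure (v.adicCompletion K) →+* ℂ_[2])
    (hθ1 : ∀ z : CBall (v.adicCompletion K), ‖θ (z : CompletedAlgClosure (v.adicCompletion K))‖ ≤ 1)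
    (e₂ : v.adicCompletionIntegers K ≃+* ℤ_[2])
    (hΘe : ∀ a : 𝒪[v.adicCompletion K], (θ.comp ((CBall (v.adicCompletion K)).subtype.comp
        (algebraMap (UnrCoeff (v.adicCompletion K)) (CBall (v.adicCompletion K))))) (intToUnrCoeff (v.adicCompletion K) a) =
      padicIntCast ℂ_[2] (((e₂ : v.adicCompletionIntegers K →+* ℤ_[2]).comp (integerEquivAdicCompletionIntegers v).toRingHom) a))
        (_ : Continuous θ)
        (_ : ∀ ζ' : ℂ_[2], (∃ n : ℕ, ζ' ^ 2 ^ n = 1) →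
          ∃ ζ : CompletedAlgClosure (v.adicCompletion K), (∃ n : ℕ, ζ ^ 2 ^ n = 1) ∧ θ ζ = ζ')
        (_ : Function.Bijective θ) (_ : ∀ z : CompletedAlgClosure (v.adicCompletion K), ‖z‖ < 1 → ‖θ z‖ < 1),
      ∃ (Ω : ℂ) (Ωp : (unrIntegers 2)ˣ) (Θε : ℂ_[2]) (τ : absoluteGaloisGroup K), Ω ≠ 0 ∧ ‖Θε‖ ≤ 1 ∧
      ∀ (S : Finset (HeightOneSpectrum (𝓞 K))), v ∉ S → vbar ∉ S →
      ∀ (𝔣 : ℕ → Ideal (𝓞 K)) (𝔩 : ℕ → HeightOneSpectrum (𝓞 K)) (𝔪c : ℕ → Ideal (𝓞 K)) (b : ℕ → ℕ)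
        (_ : 𝔣 0 = (∏ w ∈ S, w.asIdeal) * vbar.asIdeal ^ 2)
        (h𝔣succ : ∀ k, 𝔣 (k + 1) = 𝔣 k * (𝔩 k).asIdeal) (hdiv : ∀ k, (𝔩 k).asIdeal ∣ 𝔣 k)
        (_ : ∀ k, 𝔣 k = 𝔪c k * vbar.asIdeal ^ (b k + 1)) (_ : ∀ k, 1 ≤ b k)
        (_ : ∀ k, ¬ 𝔪c k ≤ v.asIdeal) (_ : ∀ k, ¬ 𝔪c k ≤ vbar.asIdeal)
        (_ : ∀ k, 𝔩 k = vbar ∨ 𝔩 k ∈ S)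
        (_ : ∀ m : ℕ, ∃ n, 𝔣 n ≤ ((∏ w ∈ S, w.asIdeal) * vbar.asIdeal) ^ m)
    (h𝔣0 : ∀ m : ℕ, 𝔣 m ≠ ⊥) (h𝔣1 : ∀ m : ℕ, 𝔣 m ≠ ⊤)
      (hvm : ∀ m : ℕ, ¬ 𝔣 m ≤ v.asIdeal)
      (hwm : ∀ (m : ℕ) (u : (𝓞 K)ˣ), (u : 𝓞 K) - 1 ∈ 𝔣 m → u = 1)
      (hle : ∀ m : ℕ, 𝔣 (m + 1) ≤ 𝔣 m)
      (α : ℕ → 𝓞 K) (hα0 : ∀ m, α m ≠ 0) (hα𝔣 : ∀ m, α m - 1 ∈ 𝔣 m)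
      (hαw : ∀ (m : ℕ) (w : HeightOneSpectrum (𝓞 K)), w ≠ v → α m ∉ w.asIdeal)
      (f : ℕ → ℕ) (hαπ : ∀ m, ((α m : K) : v.adicCompletion K) =
        ((((u : 𝒪[v.adicCompletion K]) * ((2 : ℕ) : 𝒪[v.adicCompletion K]) : 𝒪[v.adicCompletion K]) : v.adicCompletion K)) ^ f m)
      (E : ℕ → IntermediateField (v.adicCompletion K) (AlgebraicClosure (v.adicCompletion K)))
      (_ : ∀ m, FiniteDimensional (v.adicCompletion K) (E m)) (_ : ∀ m, IsGalois (v.adicCompletion K) (E m))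
      (hE : ∀ m, E m ≤ maxUnramified (v.adicCompletion K))
      (hdegE : ∀ (m : ℕ) (w : WeilGroup (v.adicCompletion K)),
        WeilGroup.toAbsGalois (v.adicCompletion K) w ∈ (E m).fixingSubgroup → (f m : ℤ) ∣ WeilGroup.deg w)
      (hEE : ∀ m, E m ≤ E (m + 1))
      (j : ∀ m : ℕ, unitBall (E m) →+* UnrCoeff (v.adicCompletion K))
      (_ : ∀ m, (j m).comp (algebraMap (LTCoeff (v.adicCompletion K)) (unitBall (E m))) =
        (intToUnrCoeff (v.adicCompletion K)).comp (LTCoeff.of (v.adicCompletion K)).symm.toRingHom)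
      (hjC : ∀ m, (algebraMap (UnrCoeff (v.adicCompletion K)) (CBall (v.adicCompletion K))).comp (j m) = unitBallToCBall (E m))
      (_ : ∀ (m : ℕ) (y : unitBall (E m)), j (m + 1) (inclUnitBall (F := v.adicCompletion K) (hEE m) y) = j m y)
      (ψ : ∀ m n : ℕ, ↥(absRestrictNormalHom (rayClassField K (𝔣 m))).ker ⧸
        (rayAdicTower (𝔪 := 𝔣 m) (h𝔣0 m) v).U n → ZMod (2 ^ (n + 1)))
      (hψ : ∀ (m n : ℕ) (g : ↥(absRestrictNormalHom (rayClassField K (𝔣 m))).ker),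
        g ∈ (rayAdicTower (𝔪 := 𝔣 m) (h𝔣0 m) v).U 0 →
        ψ m n ((rayAdicTower (𝔪 := 𝔣 m) (h𝔣0 m) v).proj n g) =
          PadicInt.toZModPow (n + 1) ((((Units.map (e₂ : v.adicCompletionIntegers K →+* ℤ_[2]).toMonoidHom).comp
            (rayAdicCharacter (h𝔣0 m) (hvm m) (hwm m)))⁻¹ g : ℤ_[2]ˣ) : ℤ_[2]))
      (g : {c : Ideal (𝓞 K) // c ≠ ⊥ ∧ IsCoprime c (𝔣 0 * v.asIdeal)} → absoluteGaloisGroup K)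
      (_ : ∀ (c : {c : Ideal (𝓞 K) // c ≠ ⊥ ∧ IsCoprime c (𝔣 0 * v.asIdeal)}) (m k : ℕ),
        absRestrictNormalHom (rayClassField K (𝔣 m * v.asIdeal ^ (k + 1))) (g c) =
          artinSymbol (galFrob K (rayClassField K (𝔣 m * v.asIdeal ^ (k + 1)))) c.1)
      (x : ∀ (_ : {c : Ideal (𝓞 K) // c ≠ ⊥ ∧ IsCoprime c (𝔣 0 * v.asIdeal)}) (m k : ℕ),
        rayClassField K (𝔣 m * v.asIdeal ^ (k + 1)))
      (hx : ∀ (c : {c : Ideal (𝓞 K) // c ≠ ⊥ ∧ IsCoprime c (𝔣 0 * v.asIdeal)}) (m k : ℕ),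
        IsThetaValueOne w₀.embedding (𝔣 m * v.asIdeal ^ (k + 1)) c.1
          (algClosureEmb w₀.embedding ((x c m k : rayClassField K (𝔣 m * v.asIdeal ^ (k + 1))) : AlgebraicClosure K)))
      (_ : ∀ m n, ((rayAdicTower (𝔪 := 𝔣 m) (h𝔣0 m) v).U n).Normal)
      (_ : ∀ m n, ((absRayAdicTower (𝔪' := 𝔣 m) (h𝔣0 m) v).U n).Normal)
      (μ : GroupDistribution (SubgroupTower.diagonal (fun m ↦ absRayAdicTower (𝔪' := 𝔣 m) (h𝔣0 m) v)
        (fun m n ↦ absRayAdicTower_U_anti (h𝔣0 m) (h𝔣0 (m + 1)) v (hle m) n)) ℂ_[2]),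
      μ.bound = 1 →
      (∀ (c : {c : Ideal (𝓞 K) // c ≠ ⊥ ∧ IsCoprime c (𝔣 0 * v.asIdeal)}) (n : ℕ)
        (b : absoluteGaloisGroup K ⧸ (absRayAdicTower (𝔪' := 𝔣 n) (h𝔣0 n) v).U n),
        (twisting (g c) (Ideal.absNorm c.1 : ℂ_[2]) μ).μ n b =
        (GroupDistribution.induceFrom (Γ := absoluteGaloisGroup K)
          (fun k ↦ rayAdicTower_U_eq_subgroupOf (𝔪 := 𝔣 n) (h𝔣0 n) v k)
          (fun b : GlobalNormCoherentUnits (h𝔣0 n) v ↦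
            localMeasureFamily (h𝔣0 n) (hvm n) (hwm n) hq h2 u (E n) (hE n) hσ₀ hε θ hθ1 (j n) (hjC n) e₂ (ψ n) (hψ n)
              (RelNormCoherentUnits.ofGlobalUnits (h𝔣0 n) (hvm n) (hwm n) (isUniformizer_unit_mul h2 u) (hα0 n) (hα𝔣 n) (hαw n)
                (hαπ n) (E n) (hE n) (hdegE n) b))
          zero_le_one (fun _ ↦ le_rfl)
          (ellipticUnitsGlobal h24iii h25 hK w₀.embedding (h𝔣0 n) (h𝔣1 n) (hvm n) (hwm n) c.2.1 (isCoprime_chain 𝔣 𝔩 h𝔣succ hdiv c.2.2 n)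
            (x c n) (hx c n))).μ n b) →
      ∃ M₁ : ℕ, ∀ (k : ℕ) (w₁ : InfinitePlace K) (lam : HeckeCharacter K) (M : ℕ), M₁ ≤ M →
          𝔣 k = modulusIdeal (insert vbar S) (fun _ ↦ M) →
          lam.HasInfinityType (fun _ ↦ 1) (fun _ ↦ 0) →
          lam.IsModulus (insert vbar S) (fun _ ↦ M) →
          modulusIdeal (insert vbar S) (fun _ ↦ M) ≠ ⊤ →
          (∀ uu : (𝓞 K)ˣ, (uu : 𝓞 K) - 1 ∈ modulusIdeal (insert vbar S) (fun _ ↦ M) → uu = 1) →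
          ∀ (χ : HeightOneSpectrum (𝓞 K) → ℂ), IsRayClassCharacter (modulusIdeal (insert vbar S) (fun _ ↦ M)) χ →
          ∀ (𝔠 : Ideal (𝓞 K)), 𝔠 ≠ ⊥ → IsCoprime 𝔠 (modulusIdeal (insert vbar S) (fun _ ↦ M)) →
            IsCoprime 𝔠 v.asIdeal →
          ∀ (εH : HeckeCharacter K) (eH : FramedGaloisRep K (PadicAlgCl 2) 1) (m : ℕ),
            IsPAdicAvatarOutside S ι εH eH → 3 ≤ m →
            εH.HasInfinityType (fun _ ↦ -(m : ℤ)) (fun _ ↦ 0) →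
            (∀ w : HeightOneSpectrum (𝓞 K), w ∉ S → w ≠ vbar → εH.IsUnramifiedAt w) →
            (SubgroupTower.diagonal (fun m ↦ absRayAdicTower (𝔪' := 𝔣 m) (h𝔣0 m) v)
                (fun m n ↦ absRayAdicTower_U_anti (h𝔣0 m) (h𝔣0 (m + 1)) v (hle m) n)).IsTowerContinuous (fun σ ↦ avatarValueAt eH σ) →
            (∀ w : HeightOneSpectrum (𝓞 K), ¬ modulusIdeal (insert vbar S) (fun _ ↦ M) ≤ w.asIdeal →
              εH.valueAtUniformizer w = (χ w)⁻¹ * (lam.valueAtUniformizer w ^ m)⁻¹) →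
            ∀ hL : LFunction.HasEntireContinuation (heckeLFunction εH),
            ∀ I' : ℂ_[2], (12 : ℂ_[2]) * I' = Θε * (twisting τ 0 μ).integral (fun σ ↦ avatarValueAt eH σ) →
            ∃ (T : Finset (Ideal (𝓞 K))) (L : Ideal (𝓞 K) → PeriodPair),
              IsRayClassReps (modulusIdeal (insert vbar S) (fun _ ↦ M)) T ∧
              (∀ 𝔟 ∈ T, ∀ z : ℂ, z ∈ (L 𝔟).lattice ↔
                ∃ x ∈ ((modulusIdeal (insert vbar S) (fun _ ↦ M) : FractionalIdeal (𝓞 K)⁰ K) /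
                  (𝔟 : FractionalIdeal (𝓞 K)⁰ K)), z = Ω * w₁.embedding x) ∧
              (∀ 𝔟 ∈ T, ∀ z : ℂ, z ∈ (L (𝔠 * 𝔟)).lattice ↔
                ∃ x ∈ ((modulusIdeal (insert vbar S) (fun _ ↦ M) : FractionalIdeal (𝓞 K)⁰ K) /
                  ((𝔠 * 𝔟 : Ideal (𝓞 K)) : FractionalIdeal (𝓞 K)⁰ K)), z = Ω * w₁.embedding x) ∧
              ((Ideal.absNorm 𝔠 : ℂ_[2]) -
                  ((ι.symm (idealPow K χ 𝔠 * idealPow K (fun w ↦ lam.valueAtUniformizer w) 𝔠 ^ m) : PadicAlgCl 2) :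
                    ℂ_[2])) * I' =
                ((ι.symm ((1 - (εH.valueAtUniformizer v)⁻¹ * (((2 : ℕ) : ℂ))⁻¹) *
                    ∑ 𝔟 ∈ T, (idealPow K χ 𝔟)⁻¹ * (idealPow K (fun w ↦ lam.valueAtUniformizer w) 𝔟 ^ m)⁻¹ *
                      ((Ideal.absNorm 𝔠 : ℂ) * (L 𝔟).eisensteinE m Ω - (L (𝔠 * 𝔟)).eisensteinE m Ω)) : PadicAlgCl 2) :
                  ℂ_[2]) * ((Ωp : unrIntegers 2) : ℂ_[2]) ^ m) :
    Summit.BirchSwinnertonDyer.BirchSwinnertonDyer.Theses.PrintCf2RubinValueTwo.KatzDistributionsAtTwoJZeroClassOne :=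
  DeShalit1987.katzDistributions₂₀_of_inlineLMeasures₀_classNumberOne 2
    (lMeasureJZero_classNumberOne_two_of_perLevel h24i h24ii h24iii h25 h27 hP1)

end LastLink

end Summit.BirchSwinnertonDyer.BirchSwinnertonDyer.Theorems.PrintCf2.KatzMeasureJZeroTop

end
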